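import Literature.NumberTheory.Adeles.FiniteAdeleLatticeOfGLDecomposition
import Literature.NumberTheory.ComplexMultiplication.CMAlgebraLatticeMaximalOrderSandwich
import Literature.AlgebraicGeometry.ModuliOfAbelianVarieties.SiegelCanonicalModel
import HarnessLib

/-!
# The lattice of a point `[J, a]` read in the CM algebra `F` is a FULL lattice, hence sandwiched between fractional-ideal
# products: `N·⊕ᵢ𝔟ᵢ ⊆ q⁻¹Λ_a ⊆ ⊕ᵢ𝔟ᵢ` ([Shimura 1998] §6.2 proof of Thm. 3, §18.8; [Milne 2005] §4; [Deligne 1971] 4.18)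

Topic `AlgebraicGeometry/ModuliOfAbelianVarieties`; namespace `Literature.AlgebraicGeometry.ModuliOfAbelianVarieties.CMStructure`.
THEOREMS ONLY (no definition, no named fact, no instance, no `sorry`; net Literature debt **0**).  Cell hodgecm-mathlib (D-0151),
#60 road / Mumford line, the provenance leaf (β0)+(β↓) of M3a-β (A-p06 CENSUS-M3a e159c28d §4 «sandwich» row: «needs
`q⁻¹(latticeOfGL a)` as a full ℤ-lattice of `F` — full rank from ★ `nonempty_basis_latticeOfGL` + `q` bijective»; B-p09's junction
certificate `SlotTest-M3a-routeXi-assembly` 8e73fbf4 Prop `CompletedSandwich`, clause (β↓)).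

## The mathematics

For a CM structure `c` on `(ℚ^{2g}, ψ_δ)` by `F = ∏ᵢ Kᵢ` ([Deligne1971TravauxShimura] 4.18, ★ `CMStructure`) with a CYCLIC vector `v`
(`q : x ↦ act(x)·v` a bijection `F → ℚ^{2g}`, ★ R60-14 `exists_bijective_act`) and `a ∈ GL_{2g}(𝔸_{ℚ,f})`, the lattice of the point
`[J, a]` is `Λ_a = ℚ^{2g} ∩ a·ẑ^{2g}` (★ R60-19 `Adeles.latticeOfGL`); read in `F` it is the `ℤ`-submodule `q⁻¹Λ_a` of `F`
(`Submodule.comap` along `q`).  §1: `Λ_a` is COFINAL in `ℚ^{2g}` — every rational vector has a non-zero integer multiple in `Λ_a`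
(★ `exists_nat_mul_entries_mem`: `N eᵢ ∈ Λ_a`; clear the denominators of `w`).  §2: `q⁻¹Λ_a` is a FULL `ℤ`-lattice of `F` in the
sense of ★ `Automorphic.IsFullLattice` (finitely generated — the image of ★ `nonempty_basis_latticeOfGL`'s lattice under the linear
bijection `q⁻¹` — and cofinal).  §3 HEAD: hence ★ R60-40a `exists_fractionalIdeal_sandwich` applies — there are NON-ZERO fractional
ideals `𝔟ᵢ` (here as units) and `N ≥ 1` with `x ∈ q⁻¹Λ_a ⇒ xᵢ ∈ 𝔟ᵢ` and `x ∈ ⊕𝔟ᵢ ⇒ N·x ∈ q⁻¹Λ_a` — Shimura's «commensurable with a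
product of ideals» ([Shimura1998] §6.2 proof of Thm. 3 p. 42, §18.8 p. 130), the RATIONAL one-sided sandwich which ★ R60-35b
(`SiegelCMLatticeReciprocityConverse`) turns into the adelic hypotheses of ★ R60-35 / R60-43 / R60-48.
Nothing printed is asserted as a fact.  HC_CM is proved only modulo the 7 printed citations until rung 0 closes.

## References
* [Shimura1998] G. Shimura, *Abelian Varieties with Complex Multiplication and Modular Functions* (1998), §6.2 proof of Thm. 3 p. 42;
  §18.8 p. 130.
* [Milne2005ShimuraVarieties] J. S. Milne, *Introduction to Shimura varieties* (2005), §4 pp. 48–49 («`V ∩ gΛ̂` is a lattice»).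
* [Deligne1971TravauxShimura] P. Deligne, *Travaux de Shimura*, Sém. Bourbaki 389 (1971), 4.18 p. 150.
* [PlatonovRapinchuk1994] V. Platonov, A. Rapinchuk, *Algebraic groups and number theory* (1994), §8.1.
-/

set_option autoImplicit false

noncomputable section

open scoped nonZeroDivisors
open Module Function NumberField Matrix IsDedekindDomain

namespace Literature.AlgebraicGeometry.ModuliOfAbelianVarieties

open Literature.NumberTheory.Automorphic (IsFullLattice integralFiniteAdeles)
open Literature.NumberTheory.Adeles (latticeOfGL mem_latticeOfGL_iff exists_nat_mul_entries_mem natCast_smul_single_mem_latticeOfGL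
  nonempty_basis_latticeOfGL)
open Literature.NumberTheory.ComplexMultiplication (exists_fractionalIdeal_sandwich)

variable {g : ℕ} {δ : Fin g → ℕ}

/-! ### §1. `Λ_a` is cofinal in `ℚ^{2g}`: every rational vector has a non-zero multiple in `Λ_a` -/

/-- A rational vector has a common denominator: `∃ D ≥ 1` with `D·wᵢ ∈ ℤ` for all `i`. [folklore] -/
private theorem exists_nat_forall_int_mul {n : Type} [Fintype n] (w : n → ℚ) :
    ∃ D : ℕ, D ≠ 0 ∧ ∀ i, ∃ z : ℤ, (z : ℚ) = D * w i := by
  classical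
  refine ⟨∏ i, (w i).den, Finset.prod_ne_zero_iff.2 fun i _ => (w i).den_nz, fun i => ?_⟩
  obtain ⟨k, hk⟩ := Finset.dvd_prod_of_mem (fun j => (w j).den) (Finset.mem_univ i)
  refine ⟨k * (w i).num, ?_⟩
  rw [hk, Nat.cast_mul, mul_comm ((w i).den : ℚ), mul_assoc, Rat.den_mul_eq_num, Int.cast_mul, Int.cast_natCast]

/-- **`Λ_a` is cofinal in `ℚ^{2g}`**: for every `w ∈ ℚⁿ` there is `m ≠ 0` in `ℤ` with `m·w ∈ Λ_a` (`N eᵢ ∈ Λ_a` for a common denominator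
`N` of `a⁻¹`, ★ `natCast_smul_single_mem_latticeOfGL`; clear the denominators of `w`). [cite: Milne2005ShimuraVarieties, §4 pp. 48–49]
[cite: PlatonovRapinchuk1994, §8.1] -/
theorem exists_zsmul_mem_latticeOfGL {n : Type} [Fintype n] [DecidableEq n] (a : GL n finAdeleQ) (w : n → ℚ) :
    ∃ m : ℤ, m ≠ 0 ∧ m • w ∈ latticeOfGL a := by
  classical
  obtain ⟨N, hN, -, hNa'⟩ := exists_nat_mul_entries_mem a
  obtain ⟨D, hD, hDw⟩ := exists_nat_forall_int_mul w
  choose z hz using hDw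
  refine ⟨((N * D : ℕ) : ℤ), by exact_mod_cast mul_ne_zero hN hD, ?_⟩
  have hw : ((N * D : ℕ) : ℤ) • w = ∑ i, z i • ((N : ℚ) • Pi.single i 1 : n → ℚ) := by
    funext j
    rw [Pi.smul_apply, Finset.sum_apply,
      Finset.sum_eq_single j (fun i _ hij => by simp [Pi.single_eq_of_ne (Ne.symm hij)])
        (fun h => absurd (Finset.mem_univ j) h)]
    simp only [Pi.smul_apply, Pi.single_eq_same, smul_eq_mul, zsmul_eq_mul, mul_one, hz j]
    push_cast
    ring
  rw [hw]
  exact Submodule.sum_mem _ fun i _ => Submodule.smul_mem _ _ (natCast_smul_single_mem_latticeOfGL hNa' i)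

/-- `Λ_a` is finitely generated (it has a `ℤ`-basis, ★ `nonempty_basis_latticeOfGL`). [cite: PlatonovRapinchuk1994, §8.1] -/
theorem fg_latticeOfGL {n : Type} [Fintype n] [DecidableEq n] (a : GL n finAdeleQ) : (latticeOfGL a).FG := by
  obtain ⟨b⟩ := nonempty_basis_latticeOfGL a
  haveI : Module.Finite ℤ (latticeOfGL a) := Module.Finite.of_basis b
  exact (Submodule.fg_top _).1 Module.Finite.fg_top

/-! ### §2. `q⁻¹Λ_a` is a full `ℤ`-lattice of `F = ∏ᵢ Kᵢ` -/

namespace CMStructure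

variable {ι : Type} [Fintype ι] [DecidableEq ι] {K : ι → Type} [∀ i, Field (K i)] [∀ i, NumberField (K i)]
  [∀ i, IsCMField (K i)] (c : CMStructure g δ ι K)

omit [DecidableEq ι] in
/-- **`q⁻¹Λ_a` IS A FULL `ℤ`-LATTICE OF `F`** (★ `Automorphic.IsFullLattice`: finitely generated and cofinal) for a cyclic vector `v`
(`q = act(·)·v` bijective) and any `a ∈ GL_{2g}(𝔸_{ℚ,f})`: `q⁻¹Λ_a = q⁻¹(Λ_a)` is the image of the finitely generated `Λ_a` under the
`ℚ`-linear bijection `q⁻¹`, and `q` carries `F` onto `ℚ^{2g}` in which `Λ_a` is cofinal.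
[cite: Milne2005ShimuraVarieties, §4 pp. 48–49] [cite: Deligne1971TravauxShimura, 4.18 p. 150] -/
theorem isFullLattice_comap_act_latticeOfGL {v : Fin g ⊕ Fin g → ℚ} (hv : Bijective fun x : Π i, K i => c.act x v)
    (a : GL (Fin g ⊕ Fin g) finAdeleQ) :
    IsFullLattice (Π i, K i) ((latticeOfGL a).comap (((LinearMap.applyₗ v).comp c.act.toLinearMap).restrictScalars ℤ)) := by
  set qℚ : (Π i, K i) →ₗ[ℚ] (Fin g ⊕ Fin g → ℚ) := (LinearMap.applyₗ v).comp c.act.toLinearMap with hqℚ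
  have hq_apply : ∀ x, qℚ x = c.act x v := fun x => rfl
  have hq_bij : Bijective qℚ := hv
  let Q : (Π i, K i) ≃ₗ[ℚ] (Fin g ⊕ Fin g → ℚ) := LinearEquiv.ofBijective qℚ hq_bij
  have hQ : ∀ x, Q x = c.act x v := fun x => rfl
  -- `q⁻¹Λ_a = Q⁻¹(Λ_a)` as a map along the inverse equivalence
  have hcomap : (latticeOfGL a).comap (qℚ.restrictScalars ℤ) = (latticeOfGL a).map (Q.symm.toLinearMap.restrictScalars ℤ) := by
    ext x
    simp only [Submodule.mem_comap, LinearMap.restrictScalars_apply, Submodule.mem_map]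
    constructor
    · intro hx
      exact ⟨qℚ x, hx, by simp [Q]⟩
    · rintro ⟨y, hy, rfl⟩
      change qℚ (Q.symm y) ∈ latticeOfGL a
      rw [show qℚ (Q.symm y) = y from Q.apply_symm_apply y]
      exact hy
  refine ⟨?_, fun d => ?_⟩
  · rw [hcomap]
    exact (fg_latticeOfGL a).map _
  · obtain ⟨m, hm, hmem⟩ := exists_zsmul_mem_latticeOfGL a (c.act d v)
    refine ⟨m, hm, ?_⟩
    rw [Submodule.mem_comap, LinearMap.restrictScalars_apply, map_zsmul]
    exact hmem

/-! ### §3. HEAD: the rational sandwich `N·⊕ᵢ𝔟ᵢ ⊆ q⁻¹Λ_a ⊆ ⊕ᵢ𝔟ᵢ` -/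

/-- **THE LATTICE OF `[J, a]` IS SANDWICHED BETWEEN FRACTIONAL-IDEAL PRODUCTS** ([Shimura1998] §6.2 proof of Thm. 3 «commensurable»,
§18.8): for a CM structure `c` with cyclic vector `v` and `a ∈ GL_{2g}(𝔸_{ℚ,f})` there are NON-ZERO fractional ideals `𝔟ᵢ` of the
`𝓞_{Kᵢ}` and `N ≥ 1` with (β↓) `act(x)·v ∈ Λ_a ⇒ xᵢ ∈ 𝔟ᵢ` for all `i`, and `xᵢ ∈ 𝔟ᵢ` for all `i` ⇒ `act(N·x)·v ∈ Λ_a` — ★ R60-40a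
`exists_fractionalIdeal_sandwich` at the full lattice `q⁻¹Λ_a` of §2, repackaged (units, `ℕ`-scalar) in the currency of the Mumford
line's stub (C). [cite: Shimura1998, §6.2 proof of Thm. 3 p. 42; §18.8 p. 130] [cite: Milne2005ShimuraVarieties, §4 pp. 48–49]
[cite: Deligne1971TravauxShimura, 4.18 p. 150] -/
theorem exists_fractionalIdeal_sandwich_latticeOfGL {v : Fin g ⊕ Fin g → ℚ} (hv : Bijective fun x : Π i, K i => c.act x v)
    (a : GL (Fin g ⊕ Fin g) finAdeleQ) :
    ∃ (𝔟 : ∀ i, (FractionalIdeal (𝓞 (K i))⁰ (K i))ˣ) (N : ℕ), N ≠ 0 ∧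
      (∀ x : Π i, K i, c.act x v ∈ latticeOfGL a → ∀ i, x i ∈ (𝔟 i : FractionalIdeal (𝓞 (K i))⁰ (K i))) ∧
      ∀ x : Π i, K i, (∀ i, x i ∈ (𝔟 i : FractionalIdeal (𝓞 (K i))⁰ (K i))) → c.act (N • x) v ∈ latticeOfGL a := by
  obtain ⟨𝔞, N, h𝔞, hN, -, hle, hsmul⟩ := exists_fractionalIdeal_sandwich (c.isFullLattice_comap_act_latticeOfGL hv a)
  have hmem_pi : ∀ x : Π i, K i,
      x ∈ Submodule.pi Set.univ (fun i => ((𝔞 i : Submodule (𝓞 (K i)) (K i)).restrictScalars ℤ)) ↔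
        ∀ i, x i ∈ 𝔞 i := fun x => by
    simp only [Submodule.mem_pi, Set.mem_univ, forall_const, Submodule.restrictScalars_mem, FractionalIdeal.mem_coe]
  refine ⟨fun i => Units.mk0 (𝔞 i) (h𝔞 i), N.natAbs, Int.natAbs_ne_zero.2 hN, fun x hx i => ?_, fun x hx => ?_⟩
  · rw [Units.val_mk0]
    exact (hmem_pi x).1 (hle hx) i
  · have hx' : x ∈ Submodule.pi Set.univ (fun i => ((𝔞 i : Submodule (𝓞 (K i)) (K i)).restrictScalars ℤ)) :=
      (hmem_pi x).2 fun i => by simpa only [Units.val_mk0] using hx i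
    have hNx : N • x ∈ (latticeOfGL a).comap (((LinearMap.applyₗ v).comp c.act.toLinearMap).restrictScalars ℤ) := hsmul x hx'
    have habs : (N.natAbs : ℤ) • x ∈ (latticeOfGL a).comap (((LinearMap.applyₗ v).comp c.act.toLinearMap).restrictScalars ℤ) := by
      rcases Int.natAbs_eq N with h | h
      · rw [← h]; exact hNx
      · rw [show (N.natAbs : ℤ) = -N by omega, neg_smul]
        exact Submodule.neg_mem _ hNx
    rw [natCast_zsmul] at habs
    exact habs

end CMStructure

end Literature.AlgebraicGeometry.ModuliOfAbelianVarieties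

end
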